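import Summits.PneNP.PneNP.Theorems.RamseyUncertifiableSosUncertaintyDefs
import Summits.PneNP.PneNP.Theorems.RamseyUncertifiableSosUncertaintyStrongDuality
import Summits.PneNP.PneNP.Theorems.RamseyUncertifiableSosUncertaintyHadamardBessel

/-!
# Route RamseyUncertifiable, crux `SosUncertainty` (stmt-PneNP-9815), line `hadamard-bessel-defect`:
mixing with the trivial certificate, and the Hadamard–Bessel floor

Two bookkeeping facts about the line's currency `DefectBound` (vocabulary of
`RamseyUncertifiableSosUncertaintyDefs.lean`), used to reduce the open stubs `stub_levelTwoDefect` /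
`stub_higherLevelDefect` to the near-canonical weights:

* `emptyUnit` — the trivial certificate `E_∅∅` (certifies the zero weight); `IsCertificate.mix` —
  mixing a certificate for the constant weight `a` with `E_∅∅` in proportion `s : 1 − s` certifies
  `s·a`, and `cosMatrix_mix` — the singleton cosine matrix is UNCHANGED (`0 < s`); packaged as the
  registered sub-goal `certificate_mixing` and as `defectPair_antitone` (a good certificate pair at
  weights `(a₀, b₀)` yields good pairs, with the same Hadamard product of cosine matrices, at every
  `(a, b) ≤ (a₀, b₀)`), so `DefectBound t γ n G` only has content at weights cofinal in the certifiable
  ones (`defectBound_of_cofinal`).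
* `hb_floor` — the Hadamard–Bessel inequality (`stub_hadamardBessel`) at constant weights:
  `n·a·b ≤ M` whenever `M•1 − cosMatrix Q ⊙ cosMatrix Q' ⪰ 0`; i.e. `λ_max(C ⊙ C') ≥ n a b` for EVERY
  certificate pair — the floor any witness of `DefectBound` must sit above.

Elementary; no source beyond the line card. [folklore]
-/

noncomputable section

open scoped BigOperators Matrix

namespace Summit.PneNP.PneNP.Cruxes.SosUncertainty.HadamardBesselDefect

open Finset Matrix Literature.Combinatorics.SimpleGraph

set_option linter.dupNamespace false -- `Summit.PneNP.PneNP.…`: summit = sub-problem name (D-0017)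

variable {V : Type*} [Fintype V] [DecidableEq V] {t : ℕ}

/-! ### The trivial certificate `E_∅∅` -/

/-- Indicator of the index `∅` in `P_t(V)`. [folklore] -/
def emptyInd (I : Idx V t) : ℝ := if I.1 = ∅ then 1 else 0

/-- The trivial certificate `E_∅∅ = χ_∅ χ_∅ᵀ`: the SoS identity `1 = 1²`, certifying the zero
weight. [folklore] -/
def emptyUnit : Matrix (Idx V t) (Idx V t) ℝ := vecMulVec (emptyInd (V := V) (t := t)) emptyInd

omit [Fintype V] in
/-- Entries of `E_∅∅`. [folklore] -/
theorem emptyUnit_apply (I J : Idx V t) :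
    (emptyUnit : Matrix (Idx V t) (Idx V t) ℝ) I J = if I.1 = ∅ ∧ J.1 = ∅ then 1 else 0 := by
  simp only [emptyUnit, vecMulVec_apply, emptyInd]
  split_ifs <;> simp_all

/-- `E_∅∅ ⪰ 0`. [folklore] -/
theorem posSemidef_emptyUnit : (emptyUnit : Matrix (Idx V t) (Idx V t) ℝ).PosSemidef := by
  have h := posSemidef_vecMulVec_self_star (R := ℝ) (emptyInd (V := V) (t := t))
  rwa [star_trivial] at h

/-- Union sums of `E_∅∅`: `1` at `∅`, `0` elsewhere. [folklore] -/
theorem unionSum_emptyUnit (U : Finset V) :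
    unionSum (emptyUnit : Matrix (Idx V t) (Idx V t) ℝ) U = if U = ∅ then 1 else 0 := by
  let e : Idx V t := ⟨∅, by simp⟩
  unfold unionSum
  by_cases hU : U = ∅
  · subst hU
    rw [if_pos rfl, Fintype.sum_eq_single e, Fintype.sum_eq_single e]
    · simp [emptyUnit_apply, e]
    · intro J hJ
      rw [if_neg]
      intro h
      exact hJ (Subtype.ext ((Finset.union_eq_empty.1 h).2))
    · intro I hI
      refine Finset.sum_eq_zero fun J _ => ?_
      rw [if_neg]
      intro h
      exact hI (Subtype.ext ((Finset.union_eq_empty.1 h).1))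
  · rw [if_neg hU]
    refine Finset.sum_eq_zero fun I _ => Finset.sum_eq_zero fun J _ => ?_
    split_ifs with h
    · rw [emptyUnit_apply, if_neg]
      rintro ⟨hI, hJ⟩
      apply hU
      rw [← h, hI, hJ, Finset.empty_union]
    · rfl

/-! ### Mixing -/

omit [Fintype V] in
/-- Union sums are additive. [folklore] -/
theorem unionSum_add [Fintype V] (P Q : Matrix (Idx V t) (Idx V t) ℝ) (U : Finset V) :
    unionSum (P + Q) U = unionSum P U + unionSum Q U := by
  simp only [unionSum, ← Finset.sum_add_distrib, Matrix.add_apply]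
  refine Finset.sum_congr rfl fun I _ => Finset.sum_congr rfl fun J _ => ?_
  split_ifs <;> simp

/-- The mixture `mixCert s Q = s•Q + (1−s)•E_∅∅` of a certificate with the trivial one. [folklore] -/
def mixCert (s : ℝ) (Q : Matrix (Idx V t) (Idx V t) ℝ) : Matrix (Idx V t) (Idx V t) ℝ :=
  s • Q + (1 - s) • emptyUnit

/-- **Mixing certifies the shrunk weight**: if `Q` certifies the constant weight `a` then
`s•Q + (1−s)•E_∅∅` certifies `s·a` (`0 ≤ s ≤ 1`). [folklore] -/
theorem IsCertificate.mix {G : SimpleGraph V} {a : ℝ} {Q : Matrix (Idx V t) (Idx V t) ℝ}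
    (hQ : IsCertificate G t (fun _ => a) Q) {s : ℝ} (hs0 : 0 ≤ s) (hs1 : s ≤ 1) :
    IsCertificate G t (fun _ => s * a) (mixCert s Q) where
  posSemidef := (hQ.posSemidef.smul hs0).add (posSemidef_emptyUnit.smul (by linarith))
  empty := by
    rw [mixCert, unionSum_add, unionSum_smul, unionSum_smul, hQ.empty, unionSum_emptyUnit, if_pos rfl]
    ring
  singleton v := by
    rw [mixCert, unionSum_add, unionSum_smul, unionSum_smul, hQ.singleton v, unionSum_emptyUnit,
      if_neg (Finset.singleton_ne_empty v)]
    ring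
  indep U hU hst := by
    have hne : U ≠ ∅ := by
      rintro rfl
      simp at hU
    rw [mixCert, unionSum_add, unionSum_smul, unionSum_smul, hQ.indep U hU hst, unionSum_emptyUnit,
      if_neg hne]
    ring

omit [Fintype V] in
/-- The singleton block of the mixture is `s` times that of `Q` (`E_∅∅` vanishes off `(∅,∅)`).
[folklore] -/
theorem vtxEntry_mix (s : ℝ) (Q : Matrix (Idx V t) (Idx V t) ℝ) (u v : V) :
    vtxEntry (mixCert s Q) u v = s * vtxEntry Q u v := by
  unfold vtxEntry
  split_ifs with ht
  · simp only [mixCert, Matrix.add_apply, Matrix.smul_apply, smul_eq_mul, emptyUnit_apply]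
    rw [if_neg]
    · ring
    · rintro ⟨hu, _⟩
      exact Finset.singleton_ne_empty u hu
  · ring

omit [Fintype V] in
/-- **Mixing keeps the singleton cosine matrix** (`0 < s`): `cos` is scale-invariant. [folklore] -/
theorem cosMatrix_mix {s : ℝ} (hs : 0 < s) (Q : Matrix (Idx V t) (Idx V t) ℝ) :
    cosMatrix (mixCert s Q) = cosMatrix Q := by
  ext u v
  simp only [cosMatrix, Matrix.of_apply, vtxEntry_mix]
  rw [Real.sqrt_mul hs.le, Real.sqrt_mul hs.le, mul_mul_mul_comm, Real.mul_self_sqrt hs.le,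
    mul_div_mul_left _ _ hs.ne']

/-- **Registered sub-goal `certificate_mixing`** (closed `∀`-form of the two facts above): a
certificate for the constant weight `a` yields, for every `0 < s ≤ 1`, a certificate for `s·a` with
the SAME singleton cosine matrix. Hence `DefectBound` has content only at weights cofinal in the
certifiable ones. [folklore] -/
theorem certificate_mixing :
    ∀ (n t : ℕ) (G : SimpleGraph (Fin n)) (a s : ℝ) (Q : Matrix (Idx (Fin n) t) (Idx (Fin n) t) ℝ),
      0 < s → s ≤ 1 → IsCertificate G t (fun _ => a) Q →
        ∃ Q' : Matrix (Idx (Fin n) t) (Idx (Fin n) t) ℝ,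
          IsCertificate G t (fun _ => s * a) Q' ∧ cosMatrix Q' = cosMatrix Q :=
  fun _ _ _ _ _ Q hs0 hs1 hQ => ⟨mixCert _ Q, hQ.mix hs0.le hs1, cosMatrix_mix hs0 Q⟩

omit [Fintype V] in
/-- Mixing with `s = 0` kills the singleton block: the cosine matrix of `E_∅∅` is `0`. [folklore] -/
theorem cosMatrix_mix_zero (Q : Matrix (Idx V t) (Idx V t) ℝ) : cosMatrix (mixCert 0 Q) = 0 := by
  ext u v
  simp [cosMatrix, vtxEntry_mix]

/-- The singleton cosine matrix of a certificate is positive semidefinite (`C ≽ c cᵀ ≽ 0`,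
`IsCertificate.exists_sq_bound_cosMatrix_sub_posSemidef`). [folklore] -/
theorem IsCertificate.posSemidef_cosMatrix {G : SimpleGraph V} {w : V → ℝ}
    {Q : Matrix (Idx V t) (Idx V t) ℝ} (hQ : IsCertificate G t w Q) : (cosMatrix Q).PosSemidef := by
  obtain ⟨c, -, hc⟩ := hQ.exists_sq_bound_cosMatrix_sub_posSemidef
  have h := posSemidef_vecMulVec_self_star (R := ℝ) c
  rw [star_trivial] at h
  simpa using hc.add h

/-- Shrinking a constant weight `a₀` to `a ∈ [0, a₀]`: a certificate whose cosine matrix is either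
unchanged (`0 < a`, or `a = a₀`) or zero (`a = 0 < a₀`). [folklore] -/
theorem IsCertificate.shrink {G : SimpleGraph V} {a₀ a : ℝ} {Q : Matrix (Idx V t) (Idx V t) ℝ}
    (hQ : IsCertificate G t (fun _ => a₀) Q) (ha : 0 ≤ a) (haa : a ≤ a₀) :
    ∃ P : Matrix (Idx V t) (Idx V t) ℝ, IsCertificate G t (fun _ => a) P ∧
      (cosMatrix P = cosMatrix Q ∨ cosMatrix P = 0) := by
  rcases haa.eq_or_lt with h | h
  · exact ⟨Q, h ▸ hQ, Or.inl rfl⟩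
  have ha₀ : 0 < a₀ := lt_of_le_of_lt ha h
  rcases ha.eq_or_lt with h0 | h0
  · subst h0
    refine ⟨mixCert 0 Q, ?_, Or.inr (cosMatrix_mix_zero Q)⟩
    simpa using hQ.mix le_rfl zero_le_one
  · refine ⟨mixCert (a / a₀) Q, ?_, Or.inl (cosMatrix_mix (div_pos h0 ha₀) Q)⟩
    simpa [div_mul_cancel₀ a ha₀.ne'] using
      hQ.mix (s := a / a₀) (div_nonneg ha ha₀.le) ((div_le_one ha₀).2 haa)

/-- **Good pairs move down**: a certificate pair at constant weights `(a₀, b₀)` with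
`M•1 − C ⊙ C' ⪰ 0` yields, at every `(a, b)` with `0 ≤ a ≤ a₀`, `0 ≤ b ≤ b₀`, a certificate pair with
the same bound (same cosine matrices after mixing, or a zero factor in the degenerate cases `a = 0` /
`b = 0`, where `M•1 ⪰ 0` because `C ⊙ C' ⪰ 0` by Schur). [folklore] -/
theorem defectPair_antitone {n t : ℕ} {G : SimpleGraph (Fin n)} {a₀ b₀ a b M : ℝ}
    {Q Q' : Matrix (Idx (Fin n) t) (Idx (Fin n) t) ℝ}
    (hQ : IsCertificate G t (fun _ => a₀) Q) (hQ' : IsCertificate Gᶜ t (fun _ => b₀) Q')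
    (hM : (M • (1 : Matrix (Fin n) (Fin n) ℝ) - cosMatrix Q ⊙ cosMatrix Q').PosSemidef)
    (ha : 0 ≤ a) (haa : a ≤ a₀) (hb : 0 ≤ b) (hbb : b ≤ b₀) :
    ∃ P P' : Matrix (Idx (Fin n) t) (Idx (Fin n) t) ℝ,
      IsCertificate G t (fun _ => a) P ∧ IsCertificate Gᶜ t (fun _ => b) P' ∧
      (M • (1 : Matrix (Fin n) (Fin n) ℝ) - cosMatrix P ⊙ cosMatrix P').PosSemidef := by
  have hM1 : (M • (1 : Matrix (Fin n) (Fin n) ℝ)).PosSemidef := by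
    simpa using hM.add (hQ.posSemidef_cosMatrix.hadamard hQ'.posSemidef_cosMatrix)
  obtain ⟨P, hP, hPC⟩ := hQ.shrink ha haa
  obtain ⟨P', hP', hPC'⟩ := hQ'.shrink hb hbb
  refine ⟨P, P', hP, hP', ?_⟩
  rcases hPC with hPC | hPC <;> rcases hPC' with hPC' | hPC'
  · rwa [hPC, hPC']
  all_goals simp [hPC, hPC', hM1]

/-- **`DefectBound` only has content at cofinal weights**: if every certifiable pair `(a, b)` is
dominated by a certifiable pair `(a₀, b₀)` carrying a good certificate pair, then `DefectBound t γ n G`.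
[folklore] -/
theorem defectBound_of_cofinal {t : ℕ} {γ : ℝ} {n : ℕ} {G : SimpleGraph (Fin n)}
    (h : ∀ a b : ℝ, 0 ≤ a → 0 ≤ b →
      (∃ Q : Matrix (Idx (Fin n) t) (Idx (Fin n) t) ℝ, IsCertificate G t (fun _ => a) Q) →
      (∃ Q' : Matrix (Idx (Fin n) t) (Idx (Fin n) t) ℝ, IsCertificate Gᶜ t (fun _ => b) Q') →
      ∃ a₀ b₀ : ℝ, a ≤ a₀ ∧ b ≤ b₀ ∧ ∃ Q Q' : Matrix (Idx (Fin n) t) (Idx (Fin n) t) ℝ,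
        IsCertificate G t (fun _ => a₀) Q ∧ IsCertificate Gᶜ t (fun _ => b₀) Q' ∧
        (((n : ℝ) ^ γ) • (1 : Matrix (Fin n) (Fin n) ℝ) - cosMatrix Q ⊙ cosMatrix Q').PosSemidef) :
    DefectBound t γ n G := by
  intro a b ha hb hca hcb
  obtain ⟨a₀, b₀, haa, hbb, Q, Q', hQ, hQ', hM⟩ := h a b ha hb hca hcb
  exact defectPair_antitone hQ hQ' hM ha haa hb hbb

/-! ### The Hadamard–Bessel floor -/

/-- **The HB floor**: for ANY certificate pair at constant nonnegative weights `a, b`,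
`M•1 − cosMatrix Q ⊙ cosMatrix Q' ⪰ 0` forces `n·a·b ≤ M` — `λ_max(C ⊙ C') ≥ n a b`
(`stub_hadamardBessel` with `Σ_v a b = n a b`). A witness of `DefectBound t γ n G` at near-canonical
weights therefore has `λ_max` squeezed in `[n/((1+ε)² las_t las_t'), n^γ]`. [folklore] -/
theorem hb_floor {n t : ℕ} {G : SimpleGraph (Fin n)} {a b M : ℝ}
    {Q Q' : Matrix (Idx (Fin n) t) (Idx (Fin n) t) ℝ} (hM0 : 0 ≤ M) (ha : 0 ≤ a) (hb : 0 ≤ b)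
    (hQ : IsCertificate G t (fun _ => a) Q) (hQ' : IsCertificate Gᶜ t (fun _ => b) Q')
    (hM : (M • (1 : Matrix (Fin n) (Fin n) ℝ) - cosMatrix Q ⊙ cosMatrix Q').PosSemidef) :
    (n : ℝ) * (a * b) ≤ M := by
  have key := stub_hadamardBessel n t G (fun _ => a) (fun _ => b) Q Q' M hM0 (fun _ => ha)
    (fun _ => hb) hQ hQ' hM
  simpa [Finset.sum_const, Finset.card_univ, Fintype.card_fin, nsmul_eq_mul] using key

end Summit.PneNP.PneNP.Cruxes.SosUncertainty.HadamardBesselDefect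

end
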